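import Summits.Parity.BatemanHorn.Theorems.SoloInformedAbelKernel
import Summits.Parity.BatemanHorn.Theorems.SoloInformedTrapezoidForm
import Summits.Parity.BatemanHorn.Theorems.SoloInformedClampVariation

/-!
# The trapezoid weight sequences `Φ_e(m) = W(m)·a_e(m)`: first variation in `m`, and in `e`

Informed soloist `solo-Parity-informed` (session 143), conjunct `BatemanHorn`, the `d ≥ 3` rung BELOW the parity
wall.  The trapezoid kernel `K_e(h) = ∑_m W(m) a_e(m) e(−hm/e)` of `SoloInformedTrapezoidForm` (`W = trapCount X₀ D`,
`a_e = locWeight g Δ e`) is the kernel sum (`SoloInformedAbelKernel.kernelSum`) of the complex sequence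
`Φ_e = trapPhi g Δ X₀ D e : m ↦ W(m)·a_e(m)` at `w = e(−h/e)` (`trapKernel_eq_kernelSum`, valid as soon as
`a_e(0) = 0`).  Here we bound, uniformly in the modulus `e`, the quantities the Abel summations consume:

* `∑_m |Φ_e(m)| ≤ D·(X₀+D+3)` (`sum_norm_trapPhi_le`);
* the first variation `V₁(Φ_e) = ∑_m |∇Φ_e(m)| ≤ 2D` (`sum_norm_bdiff_trapPhi_le`): `W` is nonincreasing with
  total drop `D`, and `a_e = cl(t_e)` with `t_e` nondecreasing beyond the vanishing range has total variation `≤ 1`;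
* the `e`-increment `Ψ_e = Φ_{e+1} − Φ_e = W·(a_{e+1} − a_e)` has `V₁(Ψ_e) ≤ 4D·σ_e`,
  `σ_e = (log(e+1) − log e)/(2Δ) ≤ 1/(2Δe)` (`sum_norm_bdiff_trapPsi_le`): `|a_{e+1} − a_e| ≤ σ_e` pointwise and
  `m ↦ a_e(m) − a_{e+1}(m) = cl(t_e(m)) − cl(t_e(m) − σ_e)` is a sliding window, unimodal in `m`
  (`SoloInformedClampVariation`).

The hypotheses are kept explicit (`g` without natural roots, `|g(m)|` nondecreasing for `m ≥ m₀`, `a_e(m) = 0` for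
`m ≤ A+1` with `m₀ ≤ A`); they are discharged for irreducible `g` of degree `≥ 2` and `e ≫ 1` by
`SoloInformedPolyDifferences` and `SoloInformedLocWeightSupport`.
-/

namespace Summit.Parity.BatemanHorn.Theorems

open Finset Polynomial

/-! ### Real sequences cast to `ℂ` -/

/-- `prev` commutes with the cast `ℝ → ℂ`. [folklore] -/
theorem prev_ofReal (r : ℕ → ℝ) (m : ℕ) : prev (fun k => ((r k : ℝ) : ℂ)) m = ((prev r m : ℝ) : ℂ) := by
  cases m <;> simp

/-- `∇` commutes with the cast `ℝ → ℂ`. [folklore] -/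
theorem bdiff_ofReal (r : ℕ → ℝ) (m : ℕ) : bdiff (fun k => ((r k : ℝ) : ℂ)) m = ((bdiff r m : ℝ) : ℂ) := by
  simp only [bdiff, prev_ofReal, Complex.ofReal_sub]

/-- `bdiff` of a cast sequence, as a function. [folklore] -/
theorem bdiff_ofReal_eq (r : ℕ → ℝ) : bdiff (fun k => ((r k : ℝ) : ℂ)) = fun m => ((bdiff r m : ℝ) : ℂ) :=
  funext (bdiff_ofReal r)

/-- `∇r(k+1) = r(k+1) − r(k)` for real sequences (restated for rewriting under `|·|`). [folklore] -/
theorem bdiff_succ_real (r : ℕ → ℝ) (k : ℕ) : bdiff r (k + 1) = r (k + 1) - r k := bdiff_succ r k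

/-! ### The sequences -/

/-- `W = trapCount X₀ D` as a complex sequence. [this work] -/
noncomputable def trapW (X₀ D : ℕ) : ℕ → ℂ := fun k => ((trapCount X₀ D k : ℝ) : ℂ)

/-- `a_e = locWeight g Δ e` as a complex sequence. [this work] -/
noncomputable def locC (g : ℤ[X]) (Δ : ℝ) (e : ℕ) : ℕ → ℂ := fun k => ((locWeight g Δ e k : ℝ) : ℂ)

/-- `a_{e+1} − a_e` as a complex sequence. [this work] -/
noncomputable def locD (g : ℤ[X]) (Δ : ℝ) (e : ℕ) : ℕ → ℂ :=
  fun k => ((locWeight g Δ (e + 1) k - locWeight g Δ e k : ℝ) : ℂ)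

/-- **`Φ_e(m) = W(m)·a_e(m)`.** [this work] -/
noncomputable def trapPhi (g : ℤ[X]) (Δ : ℝ) (X₀ D e : ℕ) : ℕ → ℂ := fun k => trapW X₀ D k * locC g Δ e k

/-- **`Ψ_e(m) = W(m)·(a_{e+1}(m) − a_e(m)) = Φ_{e+1}(m) − Φ_e(m)`.** [this work] -/
noncomputable def trapPsi (g : ℤ[X]) (Δ : ℝ) (X₀ D e : ℕ) : ℕ → ℂ := fun k => trapW X₀ D k * locD g Δ e k

/-- `Ψ_e = Φ_{e+1} − Φ_e`. [this work] -/
theorem trapPsi_eq_sub (g : ℤ[X]) (Δ : ℝ) (X₀ D e m : ℕ) :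
    trapPsi g Δ X₀ D e m = trapPhi g Δ X₀ D (e + 1) m - trapPhi g Δ X₀ D e m := by
  simp only [trapPsi, trapPhi, locD, locC, Complex.ofReal_sub]
  ring

/-- `|W(k)| = W(k)`. [this work] -/
theorem norm_trapW (X₀ D k : ℕ) : ‖trapW X₀ D k‖ = trapCount X₀ D k := by
  simp only [trapW, Complex.norm_real, Real.norm_eq_abs, Nat.abs_cast]

/-- `|W(k−1)| ≤ D`. [this work] -/
theorem norm_prev_trapW_le (X₀ D m : ℕ) : ‖prev (trapW X₀ D) m‖ ≤ D := by
  cases m with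
  | zero => simp
  | succ k => rw [prev_succ, norm_trapW]; exact_mod_cast trapCount_le X₀ D k

/-- `|∇W(k+1)| = W(k) − W(k+1)` (`W` is nonincreasing). [this work] -/
theorem norm_bdiff_trapW_succ (X₀ D k : ℕ) :
    ‖bdiff (trapW X₀ D) (k + 1)‖ = (trapCount X₀ D k : ℝ) - trapCount X₀ D (k + 1) := by
  have hle : (trapCount X₀ D (k + 1) : ℝ) ≤ trapCount X₀ D k := by exact_mod_cast trapCount_succ_le X₀ D k
  unfold trapW
  rw [bdiff_ofReal, Complex.norm_real, Real.norm_eq_abs, bdiff_succ_real, abs_sub_comm, abs_of_nonneg]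
  linarith

/-- `∑_{k<N} |∇W(k+1)| = W(0) − W(N) ≤ D`. [this work] -/
theorem sum_norm_bdiff_trapW_succ_le (X₀ D N : ℕ) :
    ∑ k ∈ range N, ‖bdiff (trapW X₀ D) (k + 1)‖ ≤ D := by
  simp only [norm_bdiff_trapW_succ]
  rw [sum_range_sub' (fun k => (trapCount X₀ D k : ℝ)) N]
  have h0 : (trapCount X₀ D 0 : ℝ) ≤ D := by exact_mod_cast trapCount_le X₀ D 0
  have hN : (0 : ℝ) ≤ trapCount X₀ D N := Nat.cast_nonneg _
  linarith

/-- `|a_e(k)| = a_e(k)`. [this work] -/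
theorem norm_locC (g : ℤ[X]) (Δ : ℝ) (e k : ℕ) : ‖locC g Δ e k‖ = locWeight g Δ e k := by
  simp only [locC, Complex.norm_real, Real.norm_eq_abs, abs_of_nonneg (locWeight_nonneg g Δ e k)]

/-- `Φ_e(m)` is the cast of the real product `W(m)·a_e(m)`. [this work] -/
theorem trapPhi_eq_ofReal (g : ℤ[X]) (Δ : ℝ) (X₀ D e m : ℕ) :
    trapPhi g Δ X₀ D e m = (((trapCount X₀ D m : ℝ) * locWeight g Δ e m : ℝ) : ℂ) := by
  simp only [trapPhi, trapW, locC, Complex.ofReal_mul]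

/-- `|Φ_e(m)| ≤ D`. [this work] -/
theorem norm_trapPhi_le (g : ℤ[X]) (Δ : ℝ) (X₀ D e m : ℕ) : ‖trapPhi g Δ X₀ D e m‖ ≤ D := by
  rw [trapPhi, norm_mul, norm_trapW, norm_locC]
  have h1 : (trapCount X₀ D m : ℝ) ≤ D := by exact_mod_cast trapCount_le X₀ D m
  have h2 := locWeight_le_one g Δ e m
  have h3 := locWeight_nonneg g Δ e m
  nlinarith

/-- `Φ_e(m) = 0` for `m > X₀ + D`. [this work] -/
theorem trapPhi_of_lt (g : ℤ[X]) (Δ : ℝ) {X₀ D m : ℕ} (hm : X₀ + D < m) (e : ℕ) :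
    trapPhi g Δ X₀ D e m = 0 := by
  simp [trapPhi, trapW, trapCount_of_lt hm]

/-- `Ψ_e(m) = 0` for `m > X₀ + D`. [this work] -/
theorem trapPsi_of_lt (g : ℤ[X]) (Δ : ℝ) {X₀ D m : ℕ} (hm : X₀ + D < m) (e : ℕ) :
    trapPsi g Δ X₀ D e m = 0 := by
  simp [trapPsi, trapW, trapCount_of_lt hm]

/-- `∑_{m ≤ X₀+D+2} |Φ_e(m)| ≤ D·(X₀+D+3)`. [this work] -/
theorem sum_norm_trapPhi_le (g : ℤ[X]) (Δ : ℝ) (X₀ D e : ℕ) :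
    ∑ m ∈ range (X₀ + D + 3), ‖trapPhi g Δ X₀ D e m‖ ≤ (D : ℝ) * ((X₀ + D + 3 : ℕ) : ℝ) := by
  calc ∑ m ∈ range (X₀ + D + 3), ‖trapPhi g Δ X₀ D e m‖ ≤ ∑ m ∈ range (X₀ + D + 3), (D : ℝ) :=
        sum_le_sum fun m _ => norm_trapPhi_le g Δ X₀ D e m
    _ = (D : ℝ) * ((X₀ + D + 3 : ℕ) : ℝ) := by rw [sum_const, card_range, nsmul_eq_mul, mul_comm]

/-! ### The trapezoid kernel is a kernel sum -/

/-- **`K_e(h) = K_N(Φ_e; e(−h/e))`** with `N = X₀ + D + 2`, as soon as `a_e(0) = 0` (so `Φ_e(0) = 0`; the top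
values `Φ_e(N−1) = Φ_e(N) = 0` hold automatically). [this work] -/
theorem trapKernel_eq_kernelSum (g : ℤ[X]) (Δ : ℝ) (X₀ D : ℕ) {e : ℕ} (h0 : locWeight g Δ e 0 = 0) (h : ℤ) :
    trapKernel g Δ X₀ D e h = kernelSum (X₀ + D + 2) (trapPhi g Δ X₀ D e) (eAdd e (-h)) := by
  rw [kernelSum_eAdd, trapKernel, range_eq_Ico, sum_eq_sum_Ico_succ_bot (by omega : 0 < X₀ + D + 2 + 1)]
  have hz : trapPhi g Δ X₀ D e 0 = 0 := by simp [trapPhi, locC, h0]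
  rw [hz, zero_mul, zero_add, show X₀ + D + 2 + 1 = (X₀ + D + 2) + 1 from rfl,
    Finset.Ico_add_one_right_eq_Icc, sum_Icc_succ_top (by omega), sum_Icc_succ_top (by omega),
    trapPhi_of_lt g Δ (by omega) e, trapPhi_of_lt g Δ (by omega) e, zero_mul, zero_mul, add_zero, add_zero]
  exact sum_congr rfl fun m _ => by rw [trapPhi_eq_ofReal]

/-! ### Monotonicity of the clamp parameter and vanishing ranges -/

/-- `t_e(m) ≤ t_e(m')` when `|g(m)| ≤ |g(m')|`, `g(m) ≠ 0`. [this work] -/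
theorem locParam_mono_of_natAbs_le (g : ℤ[X]) {Δ : ℝ} (hΔ : 0 < Δ) (e : ℕ) {m m' : ℕ}
    (hm : g.eval (m : ℤ) ≠ 0) (hle : (g.eval (m : ℤ)).natAbs ≤ (g.eval (m' : ℤ)).natAbs) :
    locParam g Δ e m ≤ locParam g Δ e m' := by
  rw [locParam_eq_add g Δ e m m']
  exact le_add_of_nonneg_right (locParam_shift_nonneg g hΔ hm hle)

/-- `t_{e+1}(m) = t_e(m) − σ_e`, `σ_e = (log(e+1) − log e)/(2Δ)`. [this work] -/
theorem locParam_succ_e (g : ℤ[X]) {Δ : ℝ} (hΔ : 0 < Δ) (e m : ℕ) :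
    locParam g Δ (e + 1) m = locParam g Δ e m - (Real.log ((e : ℝ) + 1) - Real.log e) / (2 * Δ) := by
  unfold locParam
  push_cast
  field_simp
  ring

/-- `0 ≤ σ_e`. [folklore] -/
theorem shiftWidth_nonneg {Δ : ℝ} (hΔ : 0 < Δ) (e : ℕ) :
    0 ≤ (Real.log ((e : ℝ) + 1) - Real.log e) / (2 * Δ) := by
  rcases Nat.eq_zero_or_pos e with rfl | he
  · simp
  · have he' : (0 : ℝ) < e := by exact_mod_cast he
    exact div_nonneg (sub_nonneg.mpr (Real.log_le_log he' (by linarith))) (by linarith)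

/-- `σ_e ≤ 1/(2Δe)` for `e ≥ 1`. [folklore] -/
theorem shiftWidth_le {Δ : ℝ} (hΔ : 0 < Δ) {e : ℕ} (he : 1 ≤ e) :
    (Real.log ((e : ℝ) + 1) - Real.log e) / (2 * Δ) ≤ 1 / (2 * Δ * e) := by
  have he' : (0 : ℝ) < e := by exact_mod_cast he
  have h1 : Real.log ((e : ℝ) + 1) - Real.log e ≤ 1 / e := by
    rw [← Real.log_div (by linarith) he'.ne', add_div, div_self he'.ne']
    have := Real.log_le_sub_one_of_pos (show (0 : ℝ) < 1 + 1 / e by positivity)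
    linarith
  rw [div_le_div_iff₀ (by linarith) (by positivity)]
  calc (Real.log ((e : ℝ) + 1) - Real.log e) * (2 * Δ * e) ≤ 1 / e * (2 * Δ * e) :=
        mul_le_mul_of_nonneg_right h1 (by positivity)
    _ = 1 * (2 * Δ) := by field_simp

/-- `a_{e+1}(m) ≤ a_e(m)` (`e ≥ 1`, `g(m) ≠ 0`). [this work] -/
theorem locWeight_succ_e_le (g : ℤ[X]) {Δ : ℝ} (hΔ : 0 < Δ) {e m : ℕ} (he : 1 ≤ e)
    (hm : g.eval (m : ℤ) ≠ 0) : locWeight g Δ (e + 1) m ≤ locWeight g Δ e m := by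
  rw [locWeight_eq_clamp_locParam g Δ he hm, locWeight_eq_clamp_locParam g Δ (by omega) hm]
  exact clamp_mono (locParam_antitone g hΔ m he (Nat.le_succ e))

/-- `|a_{e+1}(m) − a_e(m)| ≤ σ_e` (`e ≥ 1`, `g(m) ≠ 0`). [this work] -/
theorem abs_locWeight_succ_e_sub_le (g : ℤ[X]) {Δ : ℝ} (hΔ : 0 < Δ) {e m : ℕ} (he : 1 ≤ e)
    (hm : g.eval (m : ℤ) ≠ 0) :
    |locWeight g Δ (e + 1) m - locWeight g Δ e m| ≤ (Real.log ((e : ℝ) + 1) - Real.log e) / (2 * Δ) := by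
  rw [locWeight_eq_clamp_locParam g Δ (by omega) hm, locWeight_eq_clamp_locParam g Δ he hm, locParam_succ_e g hΔ]
  refine (Literature.NumberTheory.LFunctions.PlateauMollifier.abs_clamp_sub_clamp_le _ _).trans (le_of_eq ?_)
  rw [show locParam g Δ e m - (Real.log ((e : ℝ) + 1) - Real.log e) / (2 * Δ) - locParam g Δ e m
      = -((Real.log ((e : ℝ) + 1) - Real.log e) / (2 * Δ)) by ring, abs_neg, abs_of_nonneg (shiftWidth_nonneg hΔ e)]

/-- If `a_e(m) = 0` then `a_{e+1}(m) = 0` (`e ≥ 1`, `g(m) ≠ 0`). [this work] -/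
theorem locWeight_succ_e_eq_zero (g : ℤ[X]) {Δ : ℝ} (hΔ : 0 < Δ) {e m : ℕ} (he : 1 ≤ e)
    (hm : g.eval (m : ℤ) ≠ 0) (h0 : locWeight g Δ e m = 0) : locWeight g Δ (e + 1) m = 0 :=
  le_antisymm (h0 ▸ locWeight_succ_e_le g hΔ he hm) (locWeight_nonneg g Δ _ m)

/-! ### Total variation of `a_e` and of `a_{e+1} − a_e` in `m` -/

/-- **`TV_m(a_e) ≤ 1`**: `∑_{k<N} |a_e(k+1) − a_e(k)| ≤ 1` when `a_e(m) = 0` for `m ≤ A+1` and `|g(m)|` is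
nondecreasing for `m ≥ m₀`, `m₀ ≤ A`. [this work] -/
theorem sum_abs_locWeight_succ_sub_le_one (g : ℤ[X]) {Δ : ℝ} (hΔ : 0 < Δ) {e : ℕ} (he : 1 ≤ e)
    (hz : ∀ k : ℕ, g.eval (k : ℤ) ≠ 0) {m₀ A : ℕ} (hA : m₀ ≤ A)
    (hmono : ∀ m m' : ℕ, m₀ ≤ m → m ≤ m' → (g.eval (m : ℤ)).natAbs ≤ (g.eval (m' : ℤ)).natAbs)
    (hvan : ∀ m : ℕ, m ≤ A + 1 → locWeight g Δ e m = 0) (N : ℕ) :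
    ∑ k ∈ range N, |locWeight g Δ e (k + 1) - locWeight g Δ e k| ≤ 1 := by
  rcases le_or_gt (A + 1) N with hAN | hAN
  · rw [range_eq_Ico, ← sum_Ico_consecutive _ (Nat.zero_le (A + 1)) hAN]
    have h1 : ∑ k ∈ Ico 0 (A + 1), |locWeight g Δ e (k + 1) - locWeight g Δ e k| = 0 := by
      refine sum_eq_zero fun k hk => ?_
      rw [mem_Ico] at hk
      rw [hvan (k + 1) (by omega), hvan k (by omega), sub_zero, abs_zero]
    rw [h1, zero_add]
    have h2 : ∀ k ∈ Ico (A + 1) N, |locWeight g Δ e (k + 1) - locWeight g Δ e k|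
        = |max 0 (min 1 (locParam g Δ e (k + 1))) - max 0 (min 1 (locParam g Δ e k))| := by
      intro k _
      rw [locWeight_eq_clamp_locParam g Δ he (hz _), locWeight_eq_clamp_locParam g Δ he (hz _)]
    rw [sum_congr rfl h2]
    exact sum_abs_succ_sub_clamp_le_one (fun k => locParam g Δ e k) fun i j hi hij _ =>
      locParam_mono_of_natAbs_le g hΔ e (hz i) (hmono i j (by omega) hij)
  · refine le_trans (le_of_eq (sum_eq_zero fun k hk => ?_)) zero_le_one
    rw [mem_range] at hk
    rw [hvan (k + 1) (by omega), hvan k (by omega), sub_zero, abs_zero]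

/-- **`TV_m(a_{e+1} − a_e) ≤ 3σ_e`** under the same hypotheses: the difference is (minus) a sliding window of
width `σ_e` of the clamp, unimodal in `m`. [this work] -/
theorem sum_abs_locWeight_diff_succ_sub_le (g : ℤ[X]) {Δ : ℝ} (hΔ : 0 < Δ) {e : ℕ} (he : 1 ≤ e)
    (hz : ∀ k : ℕ, g.eval (k : ℤ) ≠ 0) {m₀ A : ℕ} (hA : m₀ ≤ A)
    (hmono : ∀ m m' : ℕ, m₀ ≤ m → m ≤ m' → (g.eval (m : ℤ)).natAbs ≤ (g.eval (m' : ℤ)).natAbs)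
    (hvan : ∀ m : ℕ, m ≤ A + 1 → locWeight g Δ e m = 0) (N : ℕ) :
    ∑ k ∈ range N, |(locWeight g Δ (e + 1) (k + 1) - locWeight g Δ e (k + 1))
        - (locWeight g Δ (e + 1) k - locWeight g Δ e k)|
      ≤ 3 * ((Real.log ((e : ℝ) + 1) - Real.log e) / (2 * Δ)) := by
  set σ := (Real.log ((e : ℝ) + 1) - Real.log e) / (2 * Δ) with hσ
  have hσ0 : 0 ≤ σ := shiftWidth_nonneg hΔ e
  have hvan' : ∀ m : ℕ, m ≤ A + 1 → locWeight g Δ (e + 1) m = 0 :=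
    fun m hm => locWeight_succ_e_eq_zero g hΔ he (hz m) (hvan m hm)
  rcases le_or_gt (A + 1) N with hAN | hAN
  · rw [range_eq_Ico, ← sum_Ico_consecutive _ (Nat.zero_le (A + 1)) hAN]
    have h1 : ∑ k ∈ Ico 0 (A + 1), |(locWeight g Δ (e + 1) (k + 1) - locWeight g Δ e (k + 1))
        - (locWeight g Δ (e + 1) k - locWeight g Δ e k)| = 0 := by
      refine sum_eq_zero fun k hk => ?_
      rw [mem_Ico] at hk
      rw [hvan (k + 1) (by omega), hvan k (by omega), hvan' (k + 1) (by omega), hvan' k (by omega)]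
      norm_num
    rw [h1, zero_add]
    have h2 : ∀ k ∈ Ico (A + 1) N, |(locWeight g Δ (e + 1) (k + 1) - locWeight g Δ e (k + 1))
        - (locWeight g Δ (e + 1) k - locWeight g Δ e k)|
        = |(max 0 (min 1 (locParam g Δ e (k + 1))) - max 0 (min 1 (locParam g Δ e (k + 1) - σ)))
            - (max 0 (min 1 (locParam g Δ e k)) - max 0 (min 1 (locParam g Δ e k - σ)))| := by
      intro k _
      rw [locWeight_eq_clamp_locParam g Δ he (hz _), locWeight_eq_clamp_locParam g Δ he (hz _),
        locWeight_eq_clamp_locParam g Δ (by omega) (hz _), locWeight_eq_clamp_locParam g Δ (by omega) (hz _),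
        locParam_succ_e g hΔ, locParam_succ_e g hΔ, ← hσ, ← abs_neg]
      congr 1
      ring
    rw [sum_congr rfl h2]
    exact sum_abs_succ_sub_clamp_window_le (fun k => locParam g Δ e k) hσ0 fun i j hi hij _ =>
      locParam_mono_of_natAbs_le g hΔ e (hz i) (hmono i j (by omega) hij)
  · refine le_trans (le_of_eq (sum_eq_zero fun k hk => ?_)) (by positivity)
    rw [mem_range] at hk
    rw [hvan (k + 1) (by omega), hvan k (by omega), hvan' (k + 1) (by omega), hvan' k (by omega)]
    norm_num

/-! ### First variations of `Φ_e` and `Ψ_e` -/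

/-- **`V₁(Φ_e) ≤ 2D`**: `∑_{m ≤ X₀+D+2} |∇Φ_e(m)| ≤ 2D` (hypotheses as in `sum_abs_locWeight_succ_sub_le_one`).
[this work] -/
theorem sum_norm_bdiff_trapPhi_le (g : ℤ[X]) {Δ : ℝ} (hΔ : 0 < Δ) (X₀ D : ℕ) {e : ℕ} (he : 1 ≤ e)
    (hz : ∀ k : ℕ, g.eval (k : ℤ) ≠ 0) {m₀ A : ℕ} (hA : m₀ ≤ A)
    (hmono : ∀ m m' : ℕ, m₀ ≤ m → m ≤ m' → (g.eval (m : ℤ)).natAbs ≤ (g.eval (m' : ℤ)).natAbs)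
    (hvan : ∀ m : ℕ, m ≤ A + 1 → locWeight g Δ e m = 0) :
    ∑ m ∈ range (X₀ + D + 3), ‖bdiff (trapPhi g Δ X₀ D e) m‖ ≤ 2 * D := by
  set N := X₀ + D + 2 with hN
  have hpt : ∀ m, ‖bdiff (trapPhi g Δ X₀ D e) m‖
      ≤ ‖bdiff (trapW X₀ D) m‖ * ‖locC g Δ e m‖ + ‖prev (trapW X₀ D) m‖ * ‖bdiff (locC g Δ e) m‖ := by
    intro m
    have h1 := bdiff_mul (trapW X₀ D) (locC g Δ e) m
    rw [show (fun k => trapW X₀ D k * locC g Δ e k) = trapPhi g Δ X₀ D e from rfl] at h1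
    rw [h1]
    exact (norm_add_le _ _).trans (by rw [norm_mul, norm_mul])
  refine (sum_le_sum fun m _ => hpt m).trans ?_
  rw [sum_add_distrib]
  -- first sum: `≤ D`
  have hS1 : ∑ m ∈ range (N + 1), ‖bdiff (trapW X₀ D) m‖ * ‖locC g Δ e m‖ ≤ D := by
    rw [sum_range_succ']
    have h0 : ‖bdiff (trapW X₀ D) 0‖ * ‖locC g Δ e 0‖ = 0 := by
      rw [norm_locC, hvan 0 (Nat.zero_le _), mul_zero]
    rw [h0, add_zero]
    refine le_trans (sum_le_sum fun k _ => ?_) (sum_norm_bdiff_trapW_succ_le X₀ D N)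
    rw [norm_locC]
    exact mul_le_of_le_one_right (norm_nonneg _) (locWeight_le_one g Δ e _)
  -- second sum: `≤ D · TV(a_e) ≤ D`
  have hS2 : ∑ m ∈ range (N + 1), ‖prev (trapW X₀ D) m‖ * ‖bdiff (locC g Δ e) m‖ ≤ D := by
    have h1 : ∀ m ∈ range (N + 1), ‖prev (trapW X₀ D) m‖ * ‖bdiff (locC g Δ e) m‖
        ≤ (D : ℝ) * ‖bdiff (locC g Δ e) m‖ :=
      fun m _ => mul_le_mul_of_nonneg_right (norm_prev_trapW_le X₀ D m) (norm_nonneg _)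
    refine (sum_le_sum h1).trans ?_
    rw [← mul_sum, sum_range_succ']
    have h0 : ‖bdiff (locC g Δ e) 0‖ = 0 := by
      rw [bdiff_zero, norm_locC, hvan 0 (Nat.zero_le _)]
    rw [h0, add_zero]
    have h2 : ∀ k ∈ range N, ‖bdiff (locC g Δ e) (k + 1)‖ = |locWeight g Δ e (k + 1) - locWeight g Δ e k| := by
      intro k _
      unfold locC
      rw [bdiff_ofReal, Complex.norm_real, Real.norm_eq_abs, bdiff_succ_real]
    rw [sum_congr rfl h2]
    exact mul_le_of_le_one_right (Nat.cast_nonneg _)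
      (sum_abs_locWeight_succ_sub_le_one g hΔ he hz hA hmono hvan N)
  linarith

/-- **`V₁(Ψ_e) ≤ 4D·σ_e`**: `∑_{m ≤ X₀+D+2} |∇Ψ_e(m)| ≤ 4D(log(e+1) − log e)/(2Δ)` (same hypotheses).
[this work] -/
theorem sum_norm_bdiff_trapPsi_le (g : ℤ[X]) {Δ : ℝ} (hΔ : 0 < Δ) (X₀ D : ℕ) {e : ℕ} (he : 1 ≤ e)
    (hz : ∀ k : ℕ, g.eval (k : ℤ) ≠ 0) {m₀ A : ℕ} (hA : m₀ ≤ A)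
    (hmono : ∀ m m' : ℕ, m₀ ≤ m → m ≤ m' → (g.eval (m : ℤ)).natAbs ≤ (g.eval (m' : ℤ)).natAbs)
    (hvan : ∀ m : ℕ, m ≤ A + 1 → locWeight g Δ e m = 0) :
    ∑ m ∈ range (X₀ + D + 3), ‖bdiff (trapPsi g Δ X₀ D e) m‖
      ≤ 4 * D * ((Real.log ((e : ℝ) + 1) - Real.log e) / (2 * Δ)) := by
  set N := X₀ + D + 2 with hN
  set σ := (Real.log ((e : ℝ) + 1) - Real.log e) / (2 * Δ) with hσ
  have hσ0 : 0 ≤ σ := shiftWidth_nonneg hΔ e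
  have hd : ∀ k, ‖locD g Δ e k‖ ≤ σ := fun k => by
    rw [locD, Complex.norm_real, Real.norm_eq_abs]; exact abs_locWeight_succ_e_sub_le g hΔ he (hz k)
  have hd0 : locD g Δ e 0 = 0 := by
    rw [locD, hvan 0 (Nat.zero_le _), locWeight_succ_e_eq_zero g hΔ he (hz 0) (hvan 0 (Nat.zero_le _))]
    simp
  have hpt : ∀ m, ‖bdiff (trapPsi g Δ X₀ D e) m‖
      ≤ ‖bdiff (trapW X₀ D) m‖ * ‖locD g Δ e m‖ + ‖prev (trapW X₀ D) m‖ * ‖bdiff (locD g Δ e) m‖ := by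
    intro m
    have h1 := bdiff_mul (trapW X₀ D) (locD g Δ e) m
    rw [show (fun k => trapW X₀ D k * locD g Δ e k) = trapPsi g Δ X₀ D e from rfl] at h1
    rw [h1]
    exact (norm_add_le _ _).trans (by rw [norm_mul, norm_mul])
  refine (sum_le_sum fun m _ => hpt m).trans ?_
  rw [sum_add_distrib]
  have hS1 : ∑ m ∈ range (N + 1), ‖bdiff (trapW X₀ D) m‖ * ‖locD g Δ e m‖ ≤ D * σ := by
    rw [sum_range_succ', hd0, norm_zero, mul_zero, add_zero]
    calc ∑ k ∈ range N, ‖bdiff (trapW X₀ D) (k + 1)‖ * ‖locD g Δ e (k + 1)‖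
        ≤ ∑ k ∈ range N, ‖bdiff (trapW X₀ D) (k + 1)‖ * σ :=
          sum_le_sum fun k _ => mul_le_mul_of_nonneg_left (hd _) (norm_nonneg _)
      _ ≤ D * σ := by
          rw [← sum_mul]; exact mul_le_mul_of_nonneg_right (sum_norm_bdiff_trapW_succ_le X₀ D N) hσ0
  have hS2 : ∑ m ∈ range (N + 1), ‖prev (trapW X₀ D) m‖ * ‖bdiff (locD g Δ e) m‖ ≤ D * (3 * σ) := by
    have h1 : ∀ m ∈ range (N + 1), ‖prev (trapW X₀ D) m‖ * ‖bdiff (locD g Δ e) m‖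
        ≤ (D : ℝ) * ‖bdiff (locD g Δ e) m‖ :=
      fun m _ => mul_le_mul_of_nonneg_right (norm_prev_trapW_le X₀ D m) (norm_nonneg _)
    refine (sum_le_sum h1).trans ?_
    rw [← mul_sum, sum_range_succ', bdiff_zero, hd0, norm_zero, add_zero]
    have h2 : ∀ k ∈ range N, ‖bdiff (locD g Δ e) (k + 1)‖
        = |(locWeight g Δ (e + 1) (k + 1) - locWeight g Δ e (k + 1))
            - (locWeight g Δ (e + 1) k - locWeight g Δ e k)| := by
      intro k _
      unfold locD
      rw [bdiff_ofReal, Complex.norm_real, Real.norm_eq_abs, bdiff_succ_real]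
    rw [sum_congr rfl h2]
    exact mul_le_mul_of_nonneg_left (sum_abs_locWeight_diff_succ_sub_le g hΔ he hz hA hmono hvan N)
      (Nat.cast_nonneg _)
  linarith

end Summit.Parity.BatemanHorn.Theorems
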